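import Mathlib
import Summits.MatrixMultiplication.MatrixMultiplication.Theses.HiddenToeplitzCorners
import Literature.Computability.AlgebraicComplexity.ArithCircuitProofs
import Literature.Computability.AlgebraicComplexity.MatMulTotalComplexityProofs
import Literature.Computability.AlgebraicComplexity.FastFourierTransform
import Literature.Computability.AlgebraicComplexity.DivisionSLP
import Literature.LinearAlgebra.Matrix.CauchyDeterminant
import Literature.LinearAlgebra.Matrix.CauchyLike
import Literature.Computability.Complexity.RandomOraclePHAsymptotics

/-!
# Stub `stub_final` of crux `HiddenToeplitzCorners.ToeplitzLikeDetCost` (stmt-MatrixMultiplication-7491),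
# line `Sketch`

Degenerate cases and the ε-bookkeeping: core bound ⇒ the crux.

The lead's core bound handles the generic case `N ≥ 1`, `d ≥ 1`, `det T(X) ≢ 0` with the cost
`s + 4·10⁴·(d+1)²·(log₂ N + 2)²·2^(log₂ N + 1)`.  Here we (i) dispatch the degenerate cases
(`det T(X) ≡ 0`, `N = 0`; `d = 0` forces `T = 0` by the injectivity of the Stein operator),
(ii) produce a nonsingular point `X₀` from `det T(X) ≢ 0` (`MvPolynomial.funext`), and
(iii) absorb the polylogarithmic factor into `r^ε`: `N ≤ r³` gives `log₂ N + 2 ≤ 4 (log₂ r + 1)`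
and `C (log₂ r + 1)² + C ≤ r^ε` eventually (the tree lemma
`Literature.Computability.Complexity.exists_nat_ge_polylog_le_rpow`).

Target tree file: `Summits/MatrixMultiplication/MatrixMultiplication/Theorems/HiddenToeplitzCornersToeplitzLikeDetCostFinal.lean`
(helper for the crux, landed with `--supports stmt-MatrixMultiplication-7491`). The theorem `stub_final`
below must keep EXACTLY this name and signature (it is registered on the crux).
-/

set_option linter.dupNamespace false

namespace Summit.MatrixMultiplication.MatrixMultiplication.Theorems

open scoped BigOperators Matrix
open Literature.Computability.AlgebraicComplexity Literature.LinearAlgebra.Matrix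
open Literature.Computability.AlgebraicComplexity.ArithCircuit (FanInTwoSeq freeInputs)
open Summit.MatrixMultiplication.MatrixMultiplication.Theses.HiddenToeplitzCorners (ToeplitzLikeDetCost)

noncomputable section

/-! ## Arithmetic bookkeeping -/

/-- `N ≤ r³` gives `log₂ N + 2 ≤ 4 (log₂ r + 1)`. [folklore] -/
theorem final_natLog_cube {r N : ℕ} (hN : N ≤ r ^ 3) :
    Nat.log 2 N + 2 ≤ 4 * (Nat.log 2 r + 1) := by
  have h1 : Nat.log 2 N ≤ Nat.log 2 (r ^ 3) := Nat.log_mono_right hN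
  have h2 : r < 2 ^ (Nat.log 2 r + 1) := Nat.lt_pow_succ_log_self one_lt_two r
  have h3 : r ^ 3 < 2 ^ (3 * (Nat.log 2 r + 1)) := by
    calc r ^ 3 < (2 ^ (Nat.log 2 r + 1)) ^ 3 := by gcongr
      _ = 2 ^ (3 * (Nat.log 2 r + 1)) := by rw [← pow_mul, mul_comm]
  have h4 : Nat.log 2 (r ^ 3) < 3 * (Nat.log 2 r + 1) := Nat.log_lt_of_lt_pow' (by omega) h3
  omega

/-- The core cost against `5120000 · d²N · (log₂ r + 1)²` (`(d+1)² ≤ 4d²`, `2^(log₂ N + 1) ≤ 2N`,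
`(log₂ N + 2)² ≤ 16 (log₂ r + 1)²`). [folklore] -/
theorem final_nat_bound {r N d : ℕ} (hN : N ≤ r ^ 3) (hN0 : 0 < N) (hd : 0 < d) :
    4 * (10000 * (d + 1) ^ 2 * (Nat.log 2 N + 2) ^ 2 * 2 ^ (Nat.log 2 N + 1)) ≤
      5120000 * (d ^ 2 * N) * (Nat.log 2 r + 1) ^ 2 := by
  have h1 : (d + 1) ^ 2 ≤ 4 * d ^ 2 := by nlinarith
  have h2 : Nat.log 2 N + 2 ≤ 4 * (Nat.log 2 r + 1) := final_natLog_cube hN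
  have h3 : 2 ^ (Nat.log 2 N + 1) ≤ 2 * N := by
    rw [pow_succ]
    have := Nat.pow_log_le_self 2 hN0.ne'
    linarith
  have h2' : (Nat.log 2 N + 2) ^ 2 ≤ 16 * (Nat.log 2 r + 1) ^ 2 := by nlinarith
  calc 4 * (10000 * (d + 1) ^ 2 * (Nat.log 2 N + 2) ^ 2 * 2 ^ (Nat.log 2 N + 1))
      ≤ 4 * (10000 * (4 * d ^ 2) * (16 * (Nat.log 2 r + 1) ^ 2) * (2 * N)) := by gcongr
    _ = 5120000 * (d ^ 2 * N) * (Nat.log 2 r + 1) ^ 2 := by ring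

/-- Final real-number bookkeeping: `c ≤ s + B`, `B ≤ 5120000·D·(l+1)²`, `5120000·(l+1)² ≤ x` and
`1 ≤ x` give `c ≤ (D + s)·x`. [folklore] -/
theorem final_real_bound {c s B : ℕ} {D x l : ℝ} (hD : 0 ≤ D) (hc : c ≤ s + B)
    (hB : (B : ℝ) ≤ 5120000 * D * (l + 1) ^ 2) (h1 : 5120000 * (l + 1) ^ 2 ≤ x) (h2 : 1 ≤ x) :
    (c : ℝ) ≤ (D + s) * x := by
  have hc' : (c : ℝ) ≤ s + B := by exact_mod_cast hc
  have hs0 : (0 : ℝ) ≤ s := Nat.cast_nonneg s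
  have h3 : D * (5120000 * (l + 1) ^ 2) ≤ D * x := mul_le_mul_of_nonneg_left h1 hD
  have h4 : (s : ℝ) ≤ s * x := le_mul_of_one_le_right hs0 h2
  nlinarith

/-! ## The stub -/

/-- **Stub `final`** — see `Lines/Sketch.lean`: the core bound (generic case) together with the
degenerate cases (`det ≡ 0`, `N = 0`, `d = 0`) and the absorption of the polylogarithmic factor
into `r^ε` yield `ToeplitzLikeDetCost`. [folklore] -/
theorem stub_final
    (hcore : ∀ (r N d : ℕ) (T : Fin r → Fin r → Matrix (Fin N) (Fin N) ℂ) (G₀ H₀ : Matrix (Fin N) (Fin d) ℂ) (G₁ H₁ : Fin r → Fin r → Matrix (Fin N) (Fin d) ℂ),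
      (∀ a b, T a b - (Matrix.of fun i j : Fin N => if (i : ℕ) = (j : ℕ) + 1 then (1 : ℂ) else 0) * T a b * (Matrix.of fun i j : Fin N => if (i : ℕ) = (j : ℕ) + 1 then (1 : ℂ) else 0)ᵀ = G₀ * (H₁ a b)ᵀ + G₁ a b * H₀ᵀ) →
      0 < N → 0 < d → (∃ X₀ : Matrix (Fin r) (Fin r) ℂ, (∑ a : Fin r, ∑ b : Fin r, X₀ a b • T a b).det ≠ 0) →
      ∃ Q : MvPolynomial (Fin r × Fin r) ℂ, Q ≠ 0 ∧
        complexity (Q * (∑ a : Fin r, ∑ b : Fin r, (MvPolynomial.X (a, b) : MvPolynomial (Fin r × Fin r) ℂ) • (T a b).map (MvPolynomial.C : ℂ → MvPolynomial (Fin r × Fin r) ℂ)).det) ≤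
          (∑ a : Fin r, ∑ b : Fin r, ((Finset.univ.filter fun p : Fin N × Fin d => G₁ a b p.1 p.2 ≠ 0).card + (Finset.univ.filter fun p : Fin N × Fin d => H₁ a b p.1 p.2 ≠ 0).card)) +
          4 * (10000 * (d + 1) ^ 2 * (Nat.log 2 N + 2) ^ 2 * 2 ^ (Nat.log 2 N + 1)))
    (hnil : ∀ (S : Type) [CommRing S] (N : ℕ) (A : Matrix (Fin N) (Fin N) S),
        A - (Matrix.of fun i j : Fin N => if (i : ℕ) = (j : ℕ) + 1 then (1 : S) else 0) * A *
          (Matrix.of fun i j : Fin N => if (i : ℕ) = (j : ℕ) + 1 then (1 : S) else 0)ᵀ = 0 → A = 0)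
    (hevalp : ∀ (r : ℕ) (m m' : Type) [Fintype m] [Fintype m'] (M : Fin r → Fin r → Matrix m m' ℂ) (x : Fin r × Fin r → ℂ),
        (∑ a : Fin r, ∑ b : Fin r, (MvPolynomial.X (a, b) : MvPolynomial (Fin r × Fin r) ℂ) • (M a b).map (MvPolynomial.C : ℂ → MvPolynomial (Fin r × Fin r) ℂ)).map (MvPolynomial.eval x) =
          ∑ a : Fin r, ∑ b : Fin r, x (a, b) • M a b) :
    ToeplitzLikeDetCost := by
  intro ε hε
  -- polylogarithms are eventually below `r^ε`
  obtain ⟨N₀, hN₀⟩ :=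
    Literature.Computability.Complexity.exists_nat_ge_polylog_le_rpow 5120000 2 1 1 hε
  filter_upwards [Filter.eventually_ge_atTop N₀, Filter.eventually_ge_atTop 1] with r hrN₀ hr1
  intro N d hNr T G₀ H₀ G₁ H₁ hStein
  have hlog : 5120000 * ((Nat.log 2 r : ℝ) + 1) ^ 2 ≤ (r : ℝ) ^ ε := by
    have h := hN₀ r hrN₀
    norm_num at h
    linarith
  have hr1' : (1 : ℝ) ≤ (r : ℝ) ^ ε := Real.one_le_rpow (by exact_mod_cast hr1) hε.le
  have hc0 : complexity (0 : MvPolynomial (Fin r × Fin r) ℂ) = 0 := by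
    simpa using complexity_C_holds (σ := Fin r × Fin r) (0 : ℂ)
  have hc1 : complexity (1 : MvPolynomial (Fin r × Fin r) ℂ) = 0 := by
    simpa using complexity_C_holds (σ := Fin r × Fin r) (1 : ℂ)
  -- the right-hand side of the cost bound is nonnegative
  have hRHS : (0 : ℝ) ≤ ((d : ℝ) ^ 2 * N + (∑ a : Fin r, ∑ b : Fin r,
      ((Finset.univ.filter fun p : Fin N × Fin d => G₁ a b p.1 p.2 ≠ 0).card +
        (Finset.univ.filter fun p : Fin N × Fin d => H₁ a b p.1 p.2 ≠ 0).card) : ℕ)) * (r : ℝ) ^ ε :=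
    mul_nonneg (add_nonneg (by positivity) (Nat.cast_nonneg _)) (Real.rpow_nonneg (Nat.cast_nonneg _) _)
  -- Case 1: the pencil determinant vanishes identically.
  by_cases hdet : (∑ a : Fin r, ∑ b : Fin r, (MvPolynomial.X (a, b) : MvPolynomial (Fin r × Fin r) ℂ) •
      (T a b).map (MvPolynomial.C : ℂ → MvPolynomial (Fin r × Fin r) ℂ)).det = 0
  · refine ⟨1, one_ne_zero, ?_⟩
    rw [hdet, mul_zero, hc0, Nat.cast_zero]
    exact hRHS
  -- Case 2: `N = 0`, the determinant is `1`.
  rcases Nat.eq_zero_or_pos N with hN0 | hNpos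
  · haveI : IsEmpty (Fin N) := ⟨fun i => absurd i.2 (by omega)⟩
    refine ⟨1, one_ne_zero, ?_⟩
    rw [Matrix.det_isEmpty, mul_one, hc1, Nat.cast_zero]
    exact hRHS
  -- Case 3: `d = 0` is impossible (the Stein operator is injective, so `T = 0`).
  rcases Nat.eq_zero_or_pos d with hd0 | hdpos
  · subst hd0
    exfalso
    apply hdet
    have hT0 : ∀ a b, T a b = 0 := fun a b =>
      hnil ℂ N (T a b) (by rw [hStein a b]; ext i j; simp)
    haveI : Nonempty (Fin N) := ⟨⟨0, hNpos⟩⟩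
    simp [hT0]
  -- Case 4: the generic case, fed to the core bound.
  have hX₀ : ∃ X₀ : Matrix (Fin r) (Fin r) ℂ, (∑ a : Fin r, ∑ b : Fin r, X₀ a b • T a b).det ≠ 0 := by
    by_contra hall
    push Not at hall
    apply hdet
    apply MvPolynomial.funext
    intro x
    rw [map_zero, RingHom.map_det, RingHom.mapMatrix_apply, hevalp r (Fin N) (Fin N) T x]
    simpa only [Matrix.of_apply] using hall (Matrix.of fun a b => x (a, b))
  obtain ⟨Q, hQ, hc⟩ := hcore r N d T G₀ H₀ G₁ H₁ hStein hNpos hdpos hX₀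
  refine ⟨Q, hQ, ?_⟩
  have hB := final_nat_bound hNr hNpos hdpos
  have hB' : ((4 * (10000 * (d + 1) ^ 2 * (Nat.log 2 N + 2) ^ 2 * 2 ^ (Nat.log 2 N + 1)) : ℕ) : ℝ) ≤
      5120000 * ((d : ℝ) ^ 2 * N) * ((Nat.log 2 r : ℝ) + 1) ^ 2 := by
    exact_mod_cast hB
  exact final_real_bound (by positivity) hc hB' hlog hr1'

end

end Summit.MatrixMultiplication.MatrixMultiplication.Theorems
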